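import Summits.ABC.IUTFork.Cor312SmallStableDHVolume
import Summits.ABC.IUTFork.Cor312FactorMapLattice
import Literature.IUT.LogVolume.LocalFieldEmbeddings
import HarnessLib

/-!
# [IUTchIII] Corollary 3.12, statement — the FIELD-BOX volume pieces `Cor312Vol.FrameVolumePieces` INHABITED at the
# Dupuy–Hilado real log-shells, and CONTAINER-ROBUSTNESS of the typed statement at the assembled real setting

Record-only file (D-0012) of the abc-iut cell (Cor. 3.12 sub-crew, seat abc-iut-c312-6, gen 5; TEAM B real-setting
lane); TAKES NO SIDE. Answers abc-iut-w5-d109's PRE-FREEZE INHABITANT CENSUS (HOME/STATUS 2026-08-26T03:41:20Z):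
«`Cor312Vol.FrameVolumePieces` still has NO term» — i.e. no kernel term of the INPUT type of abc-iut-c312-6's
per-frame assembler `FrameVolumePieces.settingOfFrameVolumes` / c312-7's `Setting.ofFrames` existed; every
frames-route theorem of the cone (`qLocal_ofFrames`, `hKumA_ofFrames`, `Cor312ThetaAdmFrames*`,
`Cor312NotPointwiseFrames`, `Cor312ProvenanceFrames`, …) was stated over `variable (V : FrameVolumePieces L)`.
(A MODEL-class producer — copies of `ℂ` with the radial volume over degenerate line data, honestly labelled «not initial
Θ-data» — landed meanwhile: abc-iut-w5-d166 `Cor312VolumesRealFramesNonVacuity`. THIS file gives the GENUINE-class term: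
the pieces AT THE DATA OF THE SETTING OF RECORD, and relates them to that setting's verbatim container.)

* §1 (over any `PadicPresentation`, abc-iut-c312-5 `Cor312VolumesPadicSummands`): the per-prime frame data —
  `factorVolume` := the Haar factor volume normalised by `μ(𝒪_{L_{v⃗,i}}) = 1` ([AbsTopIII] Prop. 5.7 (i); c312-6
  `FactorVolume.ofUltrametric`) on abc-iut-c312-3's decomposition fields `L_{v⃗,i}` ([IUTchIV] Prop. 1.4 (i)), and
  the FRAME WEIGHT `W_{(v⃗,i)} := w_{v⃗}/D_{v⃗}` (`D_{v⃗} = Σ_i e_i f_i`, campaign-S `packetDegree`); the key computation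
  `frameWeight_mul_mulLogvol`: `W_{(v⃗,i)}·μ̇^log_{L_{v⃗,i}}(λ) = (w_{v⃗}·e_i f_i/D_{v⃗})·log ‖λ‖` (abc-iut-S8
  `mulLogVolume_eq_mul_log_norm`: the Haar modulus of `λ` on `L` is `‖λ‖^{[L:ℚ_p]}`), whence
  `sum_frameWeight_mul_mulLogvol`: the weighted sum of the factor log-volumes of a hull-set `λ·𝒪_L` EQUALS the verbatim
  summandwise weighted log-volume of its field-factor preimage (abc-iut-w4-d036 `sum_w_packetLogμ_factorMap_preimage_hullSet`).
* §2 **the inhabitant** `Real.frameVolumePiecesDH X hlog : FrameVolumePieces (Real.logShellsDH X logv)`: field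
  factors / comparison = c312-5's `factorIdxDH`/`factorFieldDH`/`factorMapDH` (`Cor312SettingDHVol`: the fields of
  c312-3's decompositions `ψ_{v⃗}` at the primes, EMPTY factor index at `∞` — the Dupuy–Hilado convention of
  `Cor312VolumesRealAssembly`, recorded as a modelling choice there), comparison ONTO (c312-6 `factorMap_surjective`,
  `Cor312FactorMapLattice`), factor volumes and weights of §1, frames `HullFrame.ofLocalFields` (c312-7). Hypothesis-
  free specialisation `frameVolumePiecesDHAnalytic X` for c312-5's analytic logarithm family; `Nonempty` corollaries.
* §3 **AGREEMENT ON HULL-SETS with the verbatim container** (the kernel form of the CAVEAT in c312-6's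
  `Cor312VolumesRealFrames` module docstring «the notions AGREE ON HULL-SETS `λ·𝒪_L`»): at EVERY place, the field-box
  log-volume of `e⁻¹(λ·𝒪_L)` under `frameVolumePiecesDH` equals the summandwise normalised weighted Haar log-volume of
  the same set in c312-5's `Real.situationDHVol` ([IUTchIII] Rmk. 3.1.1 (ii)(iii), Rmk. 3.9.5 (ii); at `∞` both are
  `0`); both containers make it admissible.
* §4 the field-box TWIN of c312-5's assembled setting: `Real.situationDHFrames` (c312-5's `Situation.ofShells` fed
  with the pieces' `Adm`/`logvol`; `realizes_situationDHFrames` by `rfl`) and `Real.settingDHFrames` :=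
  `Setting.ofFrames` over `(frameVolumePiecesDH X hlog).toRealFrames thetaBox qCentre` with `hadm` DISCHARGED
  (c312-6 `hadm_of_realizes`) and the SAME binders as `Real.settingDHVol` (its `hfin` transported by §3);
  `= FrameVolumePieces.settingOfFrameVolumes …` by `rfl`.
* COMPANION (proof-only) `Cor312SettingDHFramesRobust`: CONTAINER-ROBUSTNESS — `settingDHFrames` and `settingDHVol`
  have the same frames, regions, possible images, hulls and `HullDefined` by `rfl`, and — by §3 — the same `qLocal`,
  `thetaLocal`, `ThetaFinite`, `negLogQ`, `negLogTheta`, hence `Statement ↔ Statement`: the typed Cor. 3.12 at the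
  assembled real setting of record does not depend on reading `𝕄(−)` of [IUTchIII] Rmk. 3.1.1 (iii) as boxes over the
  FIELD FACTORS (c312-6/c312-7 frames route) or as direct products over the SUMMANDS `v⃗` (c312-5 verbatim route).
Sources read on the page (gen 2 of this seat): [IUTchIII] kurims `paper:url-4b091feeb646` pp. 94–96, 115–116, 127,
173–175. [claim: Mochizuki2012, status: disputed] for the quoted container; [cite: MochizukiAbsTopIII2015, Prop. 5.7
(i)(b) p. 138]; [cite: DupuyHilado2025, Def. 3.6.1]; everything proved is bookkeeping + the Haar modulus. Deliberately
NOT here: Θ-boxes / `q`-centre (binders, owner c312-3), `IsSettingOf` (c312-8), the archimedean radial container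
(empty index at `∞` by the DH convention), any judgement. Typed ≠ proved; instantiated ≠ endorsed.
-/

noncomputable section

open Set Function MeasureTheory Metric
open scoped Pointwise ENNReal

namespace Summit.ABC

namespace IUTFork

/-! ## §1. Per-prime frame data over a `p`-adic presentation -/

namespace Cor312Vol

namespace PadicPresentation

open Thm311 Literature.IUT.LogThetaLattice Literature.IUT.LogVolume

variable {T : ThetaIndex} {L : LogShells T} {vQ : T.VQ} {p : ℕ} [Fact p.Prime] (P : PadicPresentation L vQ p)

/-- The **factor volume** on the field factor `L_{v⃗,i}`: Haar measure normalised by `μ(𝒪_L) = 1` (c312-6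
`FactorVolume.ofUltrametric` at abc-iut-c312-3's decomposition field, campaign-S Borel structure).
[cite: MochizukiAbsTopIII2015, Prop. 5.7 (i) p. 137] -/
def factorVolume (j : T.Label) (s : P.factorIdx j) : FactorVolume (P.factorField j s) :=
  FactorVolume.ofUltrametric (P.factorField j s)

/-- The **frame weight** of the field factor `(v⃗, i)`: `W_{(v⃗,i)} := w_{v⃗}/D_{v⃗}`, the summand's normalised weight
([IUTchIII] Rmk. 3.1.1 (ii)) divided by "the degree" `D_{v⃗} = Σ_i e_i f_i` of the summand ([IUTchIV] Prop. 1.4 (i)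
"normalized [i.e., by dividing by the degree]"). [cite: Mochizuki2012, IUTchIV Prop. 1.4 (i) p. 13] -/
def frameWeight (j : T.Label) (s : P.factorIdx j) : ℝ :=
  P.w j s.1 * ((packetDegree p (DFac p (P.kk s.1)) : ℝ))⁻¹

/-- Frame weights are nonnegative. [folklore] -/
theorem frameWeight_nonneg (j : T.Label) (s : P.factorIdx j) : 0 ≤ P.frameWeight j s :=
  mul_nonneg (P.w_nonneg j s.1) (inv_nonneg.mpr (Nat.cast_nonneg _))

/-- **`W_{(v⃗,i)}·μ̇^log_{L_{v⃗,i}}(λ) = (w_{v⃗}·e_i f_i/D_{v⃗})·log ‖λ‖`** for `λ ≠ 0`: the normalised Haar log-volume of `λ·𝒪_L`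
is `(e·f)·log ‖λ‖` (abc-iut-S8 `mulLogVolume_eq_mul_log_norm`, [AbsTopIII] Prop. 5.7 (i)(b); c312-6
`ofUltrametric_mulLogvol`). [cite: MochizukiAbsTopIII2015, Prop. 5.7 (i)(b) p. 138] -/
theorem frameWeight_mul_mulLogvol (j : T.Label) (s : P.factorIdx j) (x : P.factorField j s) (hx : x ≠ 0) :
    P.frameWeight j s * (P.factorVolume j s).mulLogvol x =
      (P.w j s.1 * (((packetDegree p (DFac p (P.kk s.1)) : ℝ))⁻¹ *
        ((absRamificationIdx p (DFac p (P.kk s.1) s.2) : ℝ) * residueDegree p (DFac p (P.kk s.1) s.2)))) *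
          Real.log ‖x‖ := by
  have h := FactorVolume.ofUltrametric_mulLogvol (P.factorField j s) (Units.mk0 x hx)
  rw [Units.val_mk0] at h
  unfold factorVolume frameWeight
  rw [h, mulLogVolume_eq_mul_log_norm p (P.factorField j s) (Units.mk0 x hx), Units.val_mk0]
  ring

/-- **The field-box and the summandwise log-volume of a hull-set AGREE** (one prime, closed forms on both sides):
`Σ_{(v⃗,i)} W_{(v⃗,i)}·μ̇^log_{L_{v⃗,i}}(λ_{v⃗,i}) = Σ_{v⃗} w_{v⃗}·log μ̄_{v⃗}((e⁻¹(λ·𝒪_L))_{v⃗})` for `λ_{v⃗,i} ≠ 0` — the right side is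
c312-5's verbatim container (`toLocalPieces`) on the field-factor preimage, computed by abc-iut-w4-d036
(`sum_w_packetLogμ_factorMap_preimage_hullSet`). Stated with the summand index given the finite type structure
`Fintype.ofFinite` of `toLocalPieces` (the one every assembled container uses). [claim: Mochizuki2012, status: disputed]
[cite: MochizukiAbsTopIII2015, Prop. 5.7 (i)(b) p. 138] -/
theorem sum_frameWeight_mul_mulLogvol (j : T.Label) (c : ∀ s : P.factorIdx j, P.factorField j s)
    (hc : ∀ s, c s ≠ 0) :
    haveI : Fintype (T.Caps j → T.Fibre vQ) := P.toLocalPieces.instFintype j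
    (∑ s : P.factorIdx j, P.frameWeight j s * (P.factorVolume j s).mulLogvol (c s)) =
      ∑ e : P.toLocalPieces.E j, P.toLocalPieces.w j e * P.toLocalPieces.logμ j e
        ((fun y : (∀ e' : P.toLocalPieces.E j, P.toLocalPieces.X j e') => y e) ''
          (P.toLocalPieces.e j '' ((fun x => P.factorMap j x) ⁻¹' hullSet (P.factorField j) c))) := by
  classical
  letI hCF : Fintype (T.Caps j → T.Fibre vQ) := P.toLocalPieces.instFintype j
  rw [P.sum_w_packetLogμ_factorMap_preimage_hullSet j c hc,
    Finset.sum_congr rfl fun s _ => P.frameWeight_mul_mulLogvol j s (c s) (hc s)]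
  exact Fintype.sum_sigma (fun s : P.factorIdx j => (P.w j s.1 * (((packetDegree p (DFac p (P.kk s.1)) : ℝ))⁻¹ *
    ((absRamificationIdx p (DFac p (P.kk s.1) s.2) : ℝ) * residueDegree p (DFac p (P.kk s.1) s.2)))) *
      Real.log ‖c s‖)

end PadicPresentation

end Cor312Vol

namespace Thm311

namespace Real

open Cor312 Cor312Vol Literature.IUT.LogThetaLattice Literature.IUT.LogVolume

variable {F : Type} [Field F] [NumberField F] (X : PilotData F) {logv : PadicLogs F} (hlog : LogvAnalytic logv)

/-! ## §2. The inhabitant: field-box volume pieces of the real Dupuy–Hilado-level log-shells -/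

/-- **The field-factor comparison is ONTO at every place**: at a prime c312-6's `factorMap_surjective` (c312-5's
summand comparison onto, c312-3's `ψ_{v⃗}` bijective); at `∞` the factor index is empty. [folklore] -/
theorem factorMapDH_surjective : ∀ (j : (thetaIndex X).Label) (vQ : (thetaIndex X).VQ),
    Function.Surjective (factorMapDH X hlog j vQ)
  | j, .inl u => fun t => ⟨0, funext fun s => s.elim⟩
  | j, .inr pp => by
    haveI : Fact (pp : ℕ).Prime := ⟨pp.2⟩
    exact (presAt X hlog pp).factorMap_surjective j

/-- The factor volumes of the real pieces: Haar normalised by `μ(𝒪) = 1` on each decomposition field at a prime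
(§1 `factorVolume`), nothing at `∞` (empty index). [cite: MochizukiAbsTopIII2015, Prop. 5.7 (i) p. 137] -/
def factorVolumeDH : ∀ (j : (thetaIndex X).Label) (vQ : (thetaIndex X).VQ) (s : factorIdxDH X hlog j vQ),
    FactorVolume (factorFieldDH X hlog j vQ s)
  | _, .inl _, s => s.elim
  | j, .inr pp, s => by
    haveI : Fact (pp : ℕ).Prime := ⟨pp.2⟩
    exact (presAt X hlog pp).factorVolume j s

/-- The frame weights of the real pieces: `W_{(v⃗,i)} = w_{v⃗}/D_{v⃗} = [F:ℚ]^{−(j+1)}/D_{v⃗}` at a prime (§1 `frameWeight`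
with the Dupuy–Hilado weights `weightDH`), nothing at `∞`. [cite: Mochizuki2012, IUTchIII Rmk. 3.1.1 (ii) p. 94] -/
def frameWeightDH : ∀ (j : (thetaIndex X).Label) (vQ : (thetaIndex X).VQ), factorIdxDH X hlog j vQ → ℝ
  | _, .inl _ => fun s => s.elim
  | j, .inr pp => by
    haveI : Fact (pp : ℕ).Prime := ⟨pp.2⟩
    exact fun s => (presAt X hlog pp).frameWeight j s

/-- The frame weights are nonnegative. [folklore] -/
theorem frameWeightDH_nonneg : ∀ (j : (thetaIndex X).Label) (vQ : (thetaIndex X).VQ)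
    (s : factorIdxDH X hlog j vQ), 0 ≤ frameWeightDH X hlog j vQ s
  | _, .inl _, s => s.elim
  | j, .inr pp, s => by
    haveI : Fact (pp : ℕ).Prime := ⟨pp.2⟩
    exact (presAt X hlog pp).frameWeight_nonneg j s

/-- **THE INHABITANT — the field-box volume pieces of the REAL log-shells of `F` at the Dupuy–Hilado level**:
field factors = abc-iut-c312-3's decomposition fields `L_{v⃗,i}` of the real prime packets `F_{v_0} ⊗_{ℚ_p} ⋯ ⊗_{ℚ_p} F_{v_j}`
(c312-5 `factorIdxDH`/`factorFieldDH`, empty at `∞`), comparison `factorMapDH` (onto), Haar factor volumes normalised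
at `𝒪`, weights `w_{v⃗}/D_{v⃗}`, real hull frames `HullFrame.ofLocalFields` with hull-sets `λ·𝒪_L` — the first kernel
term of c312-6's `Cor312Vol.FrameVolumePieces` ([IUTchIII] Rmk. 3.1.1 (ii)(iii) read as boxes over the field
factors; Rmk. 3.9.5 (i)(ii)). [claim: Mochizuki2012, status: disputed] -/
def frameVolumePiecesDH : FrameVolumePieces (logShellsDH X logv) where
  J := factorIdxDH X hlog
  instFintype := factorIdxDH_fintype X hlog
  K := factorFieldDH X hlog
  instField := factorFieldDH_field X hlog
  e := factorMapDH X hlog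
  e_surjective := factorMapDH_surjective X hlog
  vol := factorVolumeDH X hlog
  w := frameWeightDH X hlog
  w_nonneg := frameWeightDH_nonneg X hlog
  frameK j vQ := HullFrame.ofLocalFields (factorFieldDH X hlog j vQ)
  hul_iff _ _ _ := Iff.rfl

include hlog in
/-- Hence the type `FrameVolumePieces (Real.logShellsDH X logv)` is INHABITED for every `logv` analytic at all
primes (non-vacuity record; never-instantiated ≠ false, instantiated ≠ endorsed). [folklore] -/
theorem nonempty_frameVolumePieces : Nonempty (FrameVolumePieces (logShellsDH X logv)) :=
  ⟨frameVolumePiecesDH X hlog⟩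

/-- The pieces for c312-5's ANALYTIC logarithm family `Real.analyticLogv` — NO hypothesis beyond the pilot data
`X`. [claim: Mochizuki2012, status: disputed] -/
def frameVolumePiecesDHAnalytic : FrameVolumePieces (logShellsDH X (analyticLogv F)) :=
  frameVolumePiecesDH X (logvAnalytic_analyticLogv (F := F))

/-- … so `FrameVolumePieces (Real.logShellsDH X (Real.analyticLogv F))` is inhabited outright. [folklore] -/
theorem nonempty_frameVolumePieces_analytic : Nonempty (FrameVolumePieces (logShellsDH X (analyticLogv F))) :=
  ⟨frameVolumePiecesDHAnalytic X⟩

/-- The comparison of the pieces IS c312-5's `factorMapDH` (so `Setting.ofFrames` over them has the same regions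
as `Real.settingDHVol`). [folklore] -/
theorem frameVolumePiecesDH_e : (frameVolumePiecesDH X hlog).e = factorMapDH X hlog := rfl

/-! ## §3. Agreement with the verbatim summandwise container on hull-sets -/

section Agreement

variable (M : Type) [Field M] [NumberField M]
  (archPk : ∀ (j : (thetaIndex X).Label) (vQ : (thetaIndex X).VQ), Set ((logShellsDH X logv).Packet j vQ))
  (archSub : ∀ (j : (thetaIndex X).Label) (v : (thetaIndex X).V),
    Set ((logShellsDH X logv).Packet j ((thetaIndex X).over v)))
  (Ψ : ℤ → ∀ v : (thetaIndex X).V, v ∈ (thetaIndex X).Vbad → Set ((logShellsDH X logv).StarPacket v))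
  (act : ℤ → ∀ v : (thetaIndex X).V, v ∈ (thetaIndex X).Vbad →
    (logShellsDH X logv).StarPacket v → Module.End ℚ ((logShellsDH X logv).StarPacket v))
  (Mmod : ℤ → ∀ j : (thetaIndex X).LabelStar, Set ((logShellsDH X logv).GlobalPacket j.1))
  (region : ℤ → ∀ j : (thetaIndex X).LabelStar, FinDivisor M → ∀ vQ : (thetaIndex X).VQ,
    Set ((logShellsDH X logv).Packet j.1 vQ))
  (n : ℤ)

/-- **Field-box log-volume = verbatim summandwise log-volume on hull-set preimages, at EVERY place**: for
`λ_{v⃗,i} ≠ 0`, `Σ_{(v⃗,i)} W_{(v⃗,i)}·log μ_{L_{v⃗,i}}(λ_{v⃗,i}·𝒪) = Σ_{v⃗} w_{v⃗}·log μ̄_{v⃗}(ψ_{v⃗}⁻¹(Π_i λ_{v⃗,i}·𝒪))` (at a prime: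
c312-6's closed form `logvol_preimage_hullSet` + §1 + abc-iut-w4-d036's `logvol_situationDHVol_preimage_hullSet`; at
`∞`: both sides `0` — empty factor index resp. the weight-`0` one-point Dupuy–Hilado container). The kernel form of
«field-boxes and the printed `𝕄(−)` AGREE ON HULL-SETS» ([IUTchIII] Rmk. 3.1.1 (iii) p. 95, Rmk. 3.9.5 (ii) p. 127).
[claim: Mochizuki2012, status: disputed] [cite: MochizukiAbsTopIII2015, Prop. 5.7 (i)(b) p. 138] -/
theorem logvol_frameVolumePiecesDH_preimage_hullSet : ∀ (j : (thetaIndex X).Label) (vQ : (thetaIndex X).VQ)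
    (c : ∀ s : factorIdxDH X hlog j vQ, factorFieldDH X hlog j vQ s), (∀ s, c s ≠ 0) →
    (frameVolumePiecesDH X hlog).logvol j vQ (factorMapDH X hlog j vQ ⁻¹' hullSet (factorFieldDH X hlog j vQ) c) =
      ((situationDHVol X hlog M archPk archSub Ψ act Mmod region).D n).logvol j vQ
        (factorMapDH X hlog j vQ ⁻¹' hullSet (factorFieldDH X hlog j vQ) c)
  | j, .inl u, c, _ => by
    have h1 : (frameVolumePiecesDH X hlog).logvol j (.inl u)
        (factorMapDH X hlog j (.inl u) ⁻¹' hullSet (factorFieldDH X hlog j (.inl u)) c) = 0 := by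
      unfold FrameVolumePieces.logvol
      exact Finset.sum_eq_zero fun s _ => s.elim
    have h2 : ((situationDHVol X hlog M archPk archSub Ψ act Mmod region).D n).logvol j (.inl u)
        (factorMapDH X hlog j (.inl u) ⁻¹' hullSet (factorFieldDH X hlog j (.inl u)) c) = 0 := by
      show (summandPiecesDH X hlog).logvol j (.inl u) _ = 0
      unfold SummandPieces.logvol
      exact Finset.sum_eq_zero fun e _ => by
        show (0 : ℝ) * _ = 0
        exact zero_mul _
    rw [h1, h2]
  | j, .inr pp, c, hc => by
    haveI : Fact (pp : ℕ).Prime := ⟨pp.2⟩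
    letI hCF : Fintype ((thetaIndex X).Caps j → (thetaIndex X).Fibre (.inr pp)) := Fintype.ofFinite _
    rw [show factorMapDH X hlog j (.inr pp) ⁻¹' hullSet (factorFieldDH X hlog j (.inr pp)) c =
        (frameVolumePiecesDH X hlog).e j (.inr pp) ⁻¹' hullSet ((frameVolumePiecesDH X hlog).K j (.inr pp)) c
        from rfl, (frameVolumePiecesDH X hlog).logvol_preimage_hullSet j (.inr pp) c]
    show (∑ s : (presAt X hlog pp).factorIdx j, (presAt X hlog pp).frameWeight j s *
        ((presAt X hlog pp).factorVolume j s).mulLogvol (c s)) =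
      ((situationDHVol X hlog M archPk archSub Ψ act Mmod region).D n).logvol j (.inr pp)
        (factorMapDH X hlog j (.inr pp) ⁻¹' hullSet (factorFieldDH X hlog j (.inr pp)) c)
    exact (presAt X hlog pp).sum_frameWeight_mul_mulLogvol j c hc

/-- The same for an arbitrary hull-set `H = λ·𝒪_L`. [claim: Mochizuki2012, status: disputed] -/
theorem logvol_frameVolumePiecesDH_preimage_of_isHullSet (j : (thetaIndex X).Label) (vQ : (thetaIndex X).VQ)
    {H : Set (∀ s : factorIdxDH X hlog j vQ, factorFieldDH X hlog j vQ s)} (hH : IsHullSet (factorFieldDH X hlog j vQ) H) :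
    (frameVolumePiecesDH X hlog).logvol j vQ (factorMapDH X hlog j vQ ⁻¹' H) =
      ((situationDHVol X hlog M archPk archSub Ψ act Mmod region).D n).logvol j vQ (factorMapDH X hlog j vQ ⁻¹' H) := by
  obtain ⟨c, hc, rfl⟩ := hH
  exact logvol_frameVolumePiecesDH_preimage_hullSet X hlog M archPk archSub Ψ act Mmod region n j vQ c hc

/-- Both containers make hull-set preimages ADMISSIBLE (field-boxes: c312-6 `adm_preimage_of_isHullSet`; verbatim:
c312-5 `hadm_DH`). [cite: Mochizuki2012, IUTchIII Rmk. 3.9.5 (ii) p. 127] -/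
theorem adm_frameVolumePiecesDH_and_adm_DH (j : (thetaIndex X).Label) (vQ : (thetaIndex X).VQ)
    {H : Set (∀ s : factorIdxDH X hlog j vQ, factorFieldDH X hlog j vQ s)} (hH : IsHullSet (factorFieldDH X hlog j vQ) H) :
    (frameVolumePiecesDH X hlog).Adm j vQ (factorMapDH X hlog j vQ ⁻¹' H) ∧
      ((situationDHVol X hlog M archPk archSub Ψ act Mmod region).D n).Adm j vQ (factorMapDH X hlog j vQ ⁻¹' H) :=
  ⟨(frameVolumePiecesDH X hlog).adm_preimage_of_isHullSet j vQ hH,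
    hadm_DH X hlog M archPk archSub Ψ act Mmod region n j vQ H hH⟩

/-! ## §4. The field-box twin of the assembled real setting -/

/-- **The situation of Thm. 3.11 over the real log-shells WITH THE FIELD-BOX VOLUMES** (c312-5's
`Situation.ofShells` fed with the pieces' `Adm`/`logvol`; the other binders as in `Real.situationDHVol`).
[claim: Mochizuki2012, status: disputed] -/
abbrev situationDHFrames : Situation (thetaIndex X) :=
  Situation.ofShells (logShellsDH X logv) M archPk archSub (frameVolumePiecesDH X hlog).Adm
    (frameVolumePiecesDH X hlog).logvol Ψ act Mmod region

/-- Every line of `situationDHFrames` CARRIES the pieces' volumes (c312-6 `FrameVolumePieces.Realizes`, by `rfl`).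
[folklore] -/
theorem realizes_situationDHFrames :
    (frameVolumePiecesDH X hlog).Realizes ((situationDHFrames X hlog M archPk archSub Ψ act Mmod region).D n) :=
  ⟨fun _ _ _ => Iff.rfl, fun _ _ _ => rfl⟩

variable {HT : Type} {LogLink : HT → HT → Type} {IsFull : ∀ {s t : HT}, LogLink s t → Prop}
  (lat : LGPGaussianLogThetaLattice LogLink IsFull)
  {Frd : Type} {IsoF : Frd → Frd → Type} {Ob : Frd → Type} {realify : Frd → Frd} {Strip : Type}
  {IsoS : Strip → Strip → Type} {Mv : ∀ v : (thetaIndex X).V, v ∈ (thetaIndex X).Vbad → Type}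
  [∀ v h, Monoid (Mv v h)]
  (sig : GlobalLGPFrobenioidSignature (thetaIndex X).lstar (thetaIndex X).V (· ∈ (thetaIndex X).Vbad)
    Frd IsoF Ob realify Strip IsoS Mv)
  (split : SplittingMonoids Mv) {ObΔ : Type} {N : ∀ v : (thetaIndex X).V, v ∈ (thetaIndex X).Vbad → Type}
  [∀ v h, Monoid (N v h)] (qData : QPilotData ObΔ N)
  (thetaBox : ℤ → Ob sig.Clgp → ∀ (j : (thetaIndex X).Label) (vQ : (thetaIndex X).VQ),
    Set (∀ s : factorIdxDH X hlog j vQ, factorFieldDH X hlog j vQ s))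
  (qCentre : ObΔ → ∀ (j : (thetaIndex X).Label) (vQ : (thetaIndex X).VQ),
    ∀ s : factorIdxDH X hlog j vQ, factorFieldDH X hlog j vQ s)
  (hq : ∀ j vQ s, qCentre (qPilotObject qData) j vQ s ≠ 0)
  (hfin : ∀ j : (thetaIndex X).Label, (Function.support fun vQ =>
    ((situationDHVol X hlog M archPk archSub Ψ act Mmod region).D n).logvol j vQ
      (factorMapDH X hlog j vQ ⁻¹' hullSet (factorFieldDH X hlog j vQ) (qCentre (qPilotObject qData) j vQ))).Finite)

include hq in
/-- The `q`-support in the field-box container IS the `q`-support in the verbatim container (§3 at the nonzero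
`q`-centre), so `Real.settingDHVol`'s binder `hfin` serves both. [folklore] -/
theorem qSupport_frames_eq (j : (thetaIndex X).Label) :
    (Function.support fun vQ => ((situationDHFrames X hlog M archPk archSub Ψ act Mmod region).D n).logvol j vQ
      (factorMapDH X hlog j vQ ⁻¹' hullSet (factorFieldDH X hlog j vQ) (qCentre (qPilotObject qData) j vQ))) =
    (Function.support fun vQ => ((situationDHVol X hlog M archPk archSub Ψ act Mmod region).D n).logvol j vQ
      (factorMapDH X hlog j vQ ⁻¹' hullSet (factorFieldDH X hlog j vQ) (qCentre (qPilotObject qData) j vQ))) := by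
  ext vQ
  simp only [Function.mem_support, ne_eq]
  rw [show ((situationDHFrames X hlog M archPk archSub Ψ act Mmod region).D n).logvol j vQ
      (factorMapDH X hlog j vQ ⁻¹' hullSet (factorFieldDH X hlog j vQ) (qCentre (qPilotObject qData) j vQ)) =
      (frameVolumePiecesDH X hlog).logvol j vQ
        (factorMapDH X hlog j vQ ⁻¹' hullSet (factorFieldDH X hlog j vQ) (qCentre (qPilotObject qData) j vQ)) from rfl,
    logvol_frameVolumePiecesDH_preimage_hullSet X hlog M archPk archSub Ψ act Mmod region n j vQ _ (hq j vQ)]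

/-- **The setting of [IUTchIII] Cor. 3.12 over the REAL log-shells of `F` with the FIELD-BOX volumes** — c312-7's
`Setting.ofFrames` over the pieces' `toRealFrames thetaBox qCentre`, `hadm` DISCHARGED (c312-6 `hadm_of_realizes`),
with EXACTLY the binders of c312-5's `Real.settingDHVol` (column `n`, context data `lat`/`sig`/`split`/`qData`,
Θ-boxes, `q`-centre with `hq`, and `hfin` in its verbatim-container form, transported by `qSupport_frames_eq`).
[claim: Mochizuki2012, status: disputed] -/
def settingDHFrames : Cor312.Setting (situationDHFrames X hlog M archPk archSub Ψ act Mmod region) :=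
  Setting.ofFrames n lat sig split qData
    (FrameVolumePieces.toRealFrames (S := situationDHFrames X hlog M archPk archSub Ψ act Mmod region)
      (frameVolumePiecesDH X hlog) thetaBox qCentre) hq
    (FrameVolumePieces.hadm_of_realizes (S := situationDHFrames X hlog M archPk archSub Ψ act Mmod region)
      (V := frameVolumePiecesDH X hlog)
      (realizes_situationDHFrames X hlog M archPk archSub Ψ act Mmod region n))
    (fun j => (qSupport_frames_eq X hlog M archPk archSub Ψ act Mmod region n qData qCentre hq j).symm ▸ hfin j)

/-- `settingDHFrames` IS c312-6's `FrameVolumePieces.settingOfFrameVolumes` at the pieces (by `rfl`). [folklore] -/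
theorem settingDHFrames_eq_settingOfFrameVolumes :
    settingDHFrames X hlog M archPk archSub Ψ act Mmod region n lat sig split qData thetaBox qCentre hq hfin =
      FrameVolumePieces.settingOfFrameVolumes (S := situationDHFrames X hlog M archPk archSub Ψ act Mmod region)
        (V := frameVolumePiecesDH X hlog) lat sig split qData thetaBox qCentre hq
        (fun j => (qSupport_frames_eq X hlog M archPk archSub Ψ act Mmod region n qData qCentre hq j).symm ▸ hfin j)
        (realizes_situationDHFrames X hlog M archPk archSub Ψ act Mmod region n) :=
  rfl

/-! The container-robustness theorems (`settingDHFrames` vs `settingDHVol`: same `qLocal`, `thetaLocal`, `negLogQ`,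
`negLogTheta`, `Statement`) are in the companion `Cor312SettingDHFramesRobust`. -/

/-- Same column. [folklore] -/
theorem settingDHFrames_n :
    (settingDHFrames X hlog M archPk archSub Ψ act Mmod region n lat sig split qData thetaBox qCentre hq hfin).n = n :=
  rfl

end Agreement

end Real

end Thm311

end IUTFork

end Summit.ABC

end
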